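import Summits.Ventures.Crystal3D.Theorems.StickyWulffConstantPolycrystalWulffBoundMinkowskiSignedRefinement
import Summits.Ventures.Crystal3D.Theorems.StickyWulffConstantPolycrystalWulffBoundMinkowskiAdjacency

/-!
# `PolycrystalWulffBound`, rung `rung_basalLamellar` — step 2g: the ARRANGEMENT PACKAGE of a family of
# polyhedral grains (generic real inner product space; line `PolyDensity`, crux `stmt-Ventures-19482`)

Route `StickyWulffConstant` of the venture `Summits/Ventures/Crystal3D`, second prover lane (poly-p2,
gen 3).  From the signed refinement (`exists_signed_refinement`) of the arrangement of a unit-normal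
constraint set `𝓗` carrying pieces `𝒢` (grain `f` = the pieces `Gr f ⊆ 𝒢`, grains pairwise disjoint),
this file extracts the abstract data consumed by `volume_chimera_le_of_package` and by the exterior
calculus — with the sign vectors HIDDEN again (so that Euclidean consumers never elaborate a sign
condition): cells `Q_j`, normals `ν`, grain index sets `S f`, a grain map `gr`, the ADJACENCY list
`Adj` (grain cell `a`, exterior cell `b`, sign vectors differing exactly across one plane) with the
exterior cell's constraint `q₀ (a,b)` on that plane, and: the refinement's properties; `S`/`gr`
bookkeeping; for `(a,b) ∈ Adj` the FULL-FACE identity `cl Q_a ∩ cl Q_b = cl Q_b ∩ plane(q₀)` and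
`ν a b = ±(q₀).1`; non-adjacent grain/exterior pairs meet inside two different planes; and the COVERING
property of the chimera neighbourhood (`chimera_point_trichotomy_planes`).
WHAT THIS IS NOT: any measure estimate; nothing on the crux.
-/

noncomputable section

namespace Summit.Ventures.Crystal3D.Theorems

open MeasureTheory Set
open scoped RealInnerProductSpace Classical

variable {E : Type*} [NormedAddCommGroup E] [InnerProductSpace ℝ E] [FiniteDimensional ℝ E]
  [MeasurableSpace E] [BorelSpace E]

omit [FiniteDimensional ℝ E] [MeasurableSpace E] [BorelSpace E] in
/-- In a nonempty cell, a constraint and its antipode `(−p.1, −p.2)` carry opposite signs. -/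
theorem mem_iff_neg_notMem_of_arrCell_nonempty (𝓗 T : Finset (E × ℝ)) {p : E × ℝ} (hp : p ∈ 𝓗)
    (hp' : ((-p.1, -p.2) : E × ℝ) ∈ 𝓗)
    (hne : (⋂ q ∈ 𝓗.image (fun p : E × ℝ => if p ∈ T then p else (-p.1, -p.2)),
      {x : E | ⟪q.1, x⟫ < q.2}).Nonempty) :
    p ∈ T ↔ ((-p.1, -p.2) : E × ℝ) ∉ T := by
  obtain ⟨z, hz⟩ := hne
  rw [mem_arrCell_iff] at hz
  obtain ⟨h1, h2⟩ := hz p hp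
  obtain ⟨h3, h4⟩ := hz (-p.1, -p.2) hp'
  simp only [inner_neg_left, neg_lt_neg_iff] at h3 h4
  constructor
  · intro hpT hnT
    exact lt_asymm (h1 hpT) (h3 hnT)
  · intro hnT
    by_contra hpT
    exact lt_asymm (h2 hpT) (h4 hnT)

/-- **The arrangement package of a family of polyhedral grains.**  See the module docstring. -/
theorem exists_minkowski_package (𝓗 : Finset (E × ℝ)) (h1 : ∀ p ∈ 𝓗, ‖p.1‖ = 1)
    (𝒢 : Finset (Finset (E × ℝ))) (h𝒢 : ∀ G ∈ 𝒢, G ⊆ 𝓗)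
    (hb : ∀ G ∈ 𝒢, Bornology.IsBounded (⋂ p ∈ G, {x : E | ⟪p.1, x⟫ < p.2}))
    {n : ℕ} (hn : 0 < n) (Gr : Fin n → Finset (Finset (E × ℝ))) (hGr : ∀ f, Gr f ⊆ 𝒢)
    (hGrdisj : ∀ f g, f ≠ g → Disjoint (⋃ G ∈ Gr f, ⋂ p ∈ G, {x : E | ⟪p.1, x⟫ < p.2})
      (⋃ G ∈ Gr g, ⋂ p ∈ G, {x : E | ⟪p.1, x⟫ < p.2})) :
    ∃ (k : ℕ) (H : Fin k → Finset (E × ℝ)) (ν : Fin k → Fin k → E) (S : Fin n → Finset (Fin k))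
      (gr : Fin k → Fin n) (Adj : Finset (Fin k × Fin k)) (q₀ : Fin k × Fin k → E × ℝ),
      (∀ j, (⋂ q ∈ H j, {x : E | ⟪q.1, x⟫ < q.2}).Nonempty) ∧
      (∀ j, Bornology.IsBounded (⋂ q ∈ H j, {x : E | ⟪q.1, x⟫ < q.2})) ∧
      (∀ j, ∀ q ∈ H j, ‖q.1‖ = 1) ∧
      (∀ j, ∀ q ∈ H j, ∀ q' ∈ H j, q ≠ q' → {x : E | ⟪q.1, x⟫ = q.2} ≠ {x : E | ⟪q'.1, x⟫ = q'.2}) ∧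
      (∀ j j', j ≠ j' → Disjoint (⋂ q ∈ H j, {x : E | ⟪q.1, x⟫ < q.2}) (⋂ q ∈ H j', {x : E | ⟪q.1, x⟫ < q.2})) ∧
      (∀ i j, ν j i = -ν i j) ∧
      (∀ j j', j ≠ j' → ‖ν j j'‖ = 1 ∧ ∃ b : ℝ,
        closure (⋂ q ∈ H j, {x : E | ⟪q.1, x⟫ < q.2}) ∩ closure (⋂ q ∈ H j', {x : E | ⟪q.1, x⟫ < q.2}) ⊆
          {x : E | ⟪ν j j', x⟫ = b}) ∧
      (∀ j, (⋂ q ∈ H j, {x : E | ⟪q.1, x⟫ < q.2}) ⊆ ⋃ G ∈ 𝒢, ⋂ p ∈ G, {x : E | ⟪p.1, x⟫ < p.2}) ∧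
      ((⋃ G ∈ 𝒢, ⋂ p ∈ G, {x : E | ⟪p.1, x⟫ < p.2}) =ᵐ[volume] ⋃ j, ⋂ q ∈ H j, {x : E | ⟪q.1, x⟫ < q.2}) ∧
      (∀ j, ∀ G : Finset (E × ℝ), G ⊆ 𝓗 →
        (⋂ q ∈ H j, {x : E | ⟪q.1, x⟫ < q.2}) ⊆ (⋂ p ∈ G, {x : E | ⟪p.1, x⟫ < p.2}) ∨
        Disjoint (⋂ q ∈ H j, {x : E | ⟪q.1, x⟫ < q.2}) (⋂ p ∈ G, {x : E | ⟪p.1, x⟫ < p.2})) ∧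
      (∀ f j, j ∈ S f ↔ ∃ G ∈ Gr f, (⋂ q ∈ H j, {x : E | ⟪q.1, x⟫ < q.2}) ⊆ ⋂ p ∈ G, {x : E | ⟪p.1, x⟫ < p.2}) ∧
      (∀ f (x : E), (∀ p ∈ 𝓗, ⟪p.1, x⟫ ≠ p.2) → x ∈ (⋃ G ∈ Gr f, ⋂ p ∈ G, {x : E | ⟪p.1, x⟫ < p.2}) →
        ∃ j ∈ S f, x ∈ ⋂ q ∈ H j, {x : E | ⟪q.1, x⟫ < q.2}) ∧
      (∀ f, ∀ j ∈ S f, gr j = f) ∧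
      (∀ t ∈ Adj, t.1 ∈ S (gr t.1) ∧ (∀ g, t.2 ∉ S g) ∧ q₀ t ∈ H t.2 ∧
        closure (⋂ q ∈ H t.1, {x : E | ⟪q.1, x⟫ < q.2}) ∩ closure (⋂ q ∈ H t.2, {x : E | ⟪q.1, x⟫ < q.2}) =
          closure (⋂ q ∈ H t.2, {x : E | ⟪q.1, x⟫ < q.2}) ∩ {x : E | ⟪(q₀ t).1, x⟫ = (q₀ t).2} ∧
        (ν t.1 t.2 = (q₀ t).1 ∨ ν t.1 t.2 = -(q₀ t).1)) ∧
      (∀ f, ∀ a ∈ S f, ∀ b, (∀ g, b ∉ S g) → (a, b) ∉ Adj →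
        ∃ p ∈ 𝓗, ∃ p' ∈ 𝓗, {x : E | ⟪p.1, x⟫ = p.2} ≠ {x : E | ⟪p'.1, x⟫ = p'.2} ∧
          closure (⋂ q ∈ H a, {x : E | ⟪q.1, x⟫ < q.2}) ∩ closure (⋂ q ∈ H b, {x : E | ⟪q.1, x⟫ < q.2}) ⊆
            {x : E | ⟪p.1, x⟫ = p.2} ∩ {x : E | ⟪p'.1, x⟫ = p'.2}) ∧
      (∀ (K : Fin n → Set E) (R r : ℝ), 0 < r → (∀ f, K f ⊆ Metric.closedBall 0 R) →
        ∀ f, ∀ a ∈ S f, ∀ q ∈ (⋂ q' ∈ H a, {x : E | ⟪q'.1, x⟫ < q'.2}), ∀ w ∈ K f,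
        q + r • w ∈ (⋃ G ∈ 𝒢, ⋂ p ∈ G, {x : E | ⟪p.1, x⟫ < p.2}) →
        q + r • w ∉ (⋃ g, ⋃ a' ∈ S g, ⋂ q' ∈ H a', {x : E | ⟪q'.1, x⟫ < q'.2}) →
        (∀ p ∈ 𝓗, ⟪p.1, q + r • w⟫ ≠ p.2) →
        (∃ t ∈ Adj, gr t.1 = f ∧ q + r • w ∈ (⋂ q' ∈ H t.2, {x : E | ⟪q'.1, x⟫ < q'.2}) ∧
          (q₀ t).2 - r * sSup ((fun y => ⟪y, -(q₀ t).1⟫) '' K f) < ⟪(q₀ t).1, q + r • w⟫) ∨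
        (∃ p ∈ 𝓗, ∃ p' ∈ 𝓗, {x : E | ⟪p.1, x⟫ = p.2} ≠ {x : E | ⟪p'.1, x⟫ = p'.2} ∧
          |⟪p.1, q + r • w⟫ - p.2| ≤ r * R ∧ |⟪p'.1, q + r • w⟫ - p'.2| ≤ r * R)) := by
  obtain ⟨k, T, ν, hT𝓗, hTinj, hcompl, hgood, hsepν, hne, hantiν, hbd, hunit, hdist, hdisj, hplane,
    hinside, hae, hdich⟩ := exists_signed_refinement 𝓗 h1 𝒢 h𝒢 hb
  -- signed constraints and cells
  set sgn : Finset (E × ℝ) → Finset (E × ℝ) :=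
    fun T' => 𝓗.image (fun p : E × ℝ => if p ∈ T' then p else (-p.1, -p.2)) with hsgn
  set cell : Fin k → Set E := fun j => ⋂ q ∈ sgn (T j), {x : E | ⟪q.1, x⟫ < q.2} with hcell
  -- grain index sets and the grain map
  set S : Fin n → Finset (Fin k) := fun f => Finset.univ.filter
    (fun j => ∃ G ∈ Gr f, cell j ⊆ ⋂ p ∈ G, {x : E | ⟪p.1, x⟫ < p.2}) with hS
  have hSmem : ∀ f j, j ∈ S f ↔ ∃ G ∈ Gr f, cell j ⊆ ⋂ p ∈ G, {x : E | ⟪p.1, x⟫ < p.2} := by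
    intro f j; simp [hS]
  have hSdisj : ∀ f g j, j ∈ S f → j ∈ S g → f = g := by
    intro f g j hf hg
    by_contra hfg
    obtain ⟨G, hG, hjG⟩ := (hSmem f j).1 hf
    obtain ⟨G', hG', hjG'⟩ := (hSmem g j).1 hg
    obtain ⟨z, hz⟩ := hne j
    have h1z : z ∈ ⋃ G ∈ Gr f, ⋂ p ∈ G, {x : E | ⟪p.1, x⟫ < p.2} := mem_iUnion₂.2 ⟨G, hG, hjG hz⟩
    have h2z : z ∈ ⋃ G ∈ Gr g, ⋂ p ∈ G, {x : E | ⟪p.1, x⟫ < p.2} := mem_iUnion₂.2 ⟨G', hG', hjG' hz⟩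
    exact Set.disjoint_left.1 (hGrdisj f g hfg) h1z h2z
  set gr : Fin k → Fin n := fun j => if h : ∃ f, j ∈ S f then h.choose else ⟨0, hn⟩ with hgr
  have hgrS : ∀ f, ∀ j ∈ S f, gr j = f := by
    intro f j hj
    have hex : ∃ f, j ∈ S f := ⟨f, hj⟩
    have h1' : gr j = hex.choose := by simp only [hgr, dif_pos hex]
    rw [h1']
    exact hSdisj _ _ j hex.choose_spec hj
  -- adjacency
  set adjP : Fin k → Fin k → (E × ℝ) → Prop := fun a b p =>
    p ∈ 𝓗 ∧ ¬ (p ∈ T a ↔ p ∈ T b) ∧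
      ∀ p' ∈ 𝓗, (p' ∈ T a ↔ p' ∈ T b) ∨ {x : E | ⟪p'.1, x⟫ = p'.2} = {x : E | ⟪p.1, x⟫ = p.2}
    with hadjP
  set Adj : Finset (Fin k × Fin k) := (Finset.univ ×ˢ Finset.univ).filter
    (fun ab => (∃ f, ab.1 ∈ S f) ∧ (∀ g, ab.2 ∉ S g) ∧ ∃ p, adjP ab.1 ab.2 p) with hAdj
  have hAdjmem : ∀ ab, ab ∈ Adj ↔ (∃ f, ab.1 ∈ S f) ∧ (∀ g, ab.2 ∉ S g) ∧ ∃ p, adjP ab.1 ab.2 p := by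
    intro ab; simp [hAdj]
  set q₀ : Fin k × Fin k → E × ℝ := fun ab =>
    if h : ∃ p, adjP ab.1 ab.2 p then
      (if h.choose ∈ T ab.1 then (-(h.choose).1, -(h.choose).2) else h.choose) else (0, 0) with hq₀
  -- consistency facts about `adjP` and `q₀`
  have hadj_choose : ∀ ab : Fin k × Fin k, (h : ∃ p, adjP ab.1 ab.2 p) →
      q₀ ab = (if h.choose ∈ T ab.1 then (-(h.choose).1, -(h.choose).2) else h.choose) := by
    intro ab h
    simp only [hq₀, dif_pos h]
  -- two constraints on one plane are equal or antipodal
  have hplane_eq : ∀ p ∈ 𝓗, ∀ p' ∈ 𝓗, {x : E | ⟪p'.1, x⟫ = p'.2} = {x : E | ⟪p.1, x⟫ = p.2} →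
      p' = p ∨ p' = (-p.1, -p.2) := by
    intro p hp p' hp' hpl
    rcases eq_or_eq_neg_of_setOf_inner_eq (h1 p hp) (h1 p' hp') hpl.symm with ⟨ha, hb⟩ | ⟨ha, hb⟩
    · left; exact Prod.ext ha hb
    · right; exact Prod.ext ha hb
  -- in a nonempty cell antipodal constraints have opposite signs
  have hanti : ∀ j, ∀ p ∈ 𝓗, ((-p.1, -p.2) : E × ℝ) ∈ 𝓗 → (p ∈ T j ↔ ((-p.1, -p.2) : E × ℝ) ∉ T j) :=
    fun j p hp hp' => mem_iff_neg_notMem_of_arrCell_nonempty 𝓗 (T j) hp hp' (hne j)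
  -- the signed version of a differing constraint, seen from `b`, is the one recorded by `q₀`
  have hq₀_of_adj : ∀ (a b : Fin k) (p : E × ℝ), adjP a b p →
      q₀ (a, b) = (if p ∈ T a then (-p.1, -p.2) else p) := by
    intro a b p hp
    have hex : ∃ p', adjP a b p' := ⟨p, hp⟩
    rw [hadj_choose (a, b) hex]
    set p' := hex.choose with hp'def
    have hp'adj : adjP a b p' := hex.choose_spec
    obtain ⟨hp𝓗, hpdiff, hpagree⟩ := hp
    obtain ⟨hp'𝓗, hp'diff, -⟩ := hp'adj
    -- `p'` differs, hence lies on the plane of `p`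
    have hpl : {x : E | ⟪p'.1, x⟫ = p'.2} = {x : E | ⟪p.1, x⟫ = p.2} := by
      rcases hpagree p' hp'𝓗 with h | h
      · exact absurd h hp'diff
      · exact h
    rcases hplane_eq p hp𝓗 p' hp'𝓗 hpl with hpp | hpp
    · simp only [hpp]
    · have han := hanti a p hp𝓗 (hpp ▸ hp'𝓗)
      rw [hpp]
      by_cases hpa : p ∈ T a
      · have : ((-p.1, -p.2) : E × ℝ) ∉ T a := han.1 hpa
        simp only [hpa, this, if_true, if_false]
      · have : ((-p.1, -p.2) : E × ℝ) ∈ T a := by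
          by_contra h; exact hpa (han.2 h)
        simp only [hpa, this, if_true, if_false, neg_neg, Prod.mk.eta]
  refine ⟨k, fun j => sgn (T j), ν, S, gr, Adj, q₀, hne, hbd, hunit, hdist, hdisj, hantiν, hplane, hinside,
    hae, hdich, hSmem, ?_, hgrS, ?_, ?_, ?_⟩
  · -- P11: a point off the planes inside grain `f` lies in a cell of `S f`
    intro f x hoff hx
    obtain ⟨G, hG, hxG⟩ := mem_iUnion₂.1 hx
    have hxN : x ∉ ⋃ p ∈ 𝓗, {y : E | ⟪p.1, y⟫ = p.2} := by
      intro h; obtain ⟨p, hp, hpx⟩ := mem_iUnion₂.1 h; exact hoff p hp hpx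
    have hxT := mem_arrCell_filter 𝓗 hxN
    have hGT : G ⊆ 𝓗.filter (fun p => ⟪p.1, x⟫ < p.2) := by
      intro p hp
      exact Finset.mem_filter.2 ⟨h𝒢 G (hGr f hG) hp, (mem_iInter₂.1 hxG) p hp⟩
    obtain ⟨j, hj⟩ := hcompl _ (Finset.filter_subset _ _) ⟨G, hGr f hG, hGT⟩ ⟨x, hxT⟩
    refine ⟨j, (hSmem f j).2 ⟨G, hG, ?_⟩, ?_⟩
    · show cell j ⊆ _
      simp only [hcell, hsgn, hj]
      exact arrCell_subset_polytope 𝓗 _ (h𝒢 G (hGr f hG)) hGT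
    · show x ∈ cell j
      simp only [hcell, hsgn, hj]
      exact hxT
  · -- P13: adjacency data
    intro t ht
    obtain ⟨⟨f, hf⟩, hext, p, hp⟩ := (hAdjmem t).1 ht
    have hq := hq₀_of_adj t.1 t.2 p hp
    obtain ⟨hp𝓗, hpdiff, hpagree⟩ := hp
    have hab : t.1 ≠ t.2 := fun h => hext f (h ▸ hf)
    refine ⟨(hgrS f t.1 hf).symm ▸ hf, hext, ?_, ?_, ?_⟩
    · -- `q₀ t ∈ H t.2`
      show q₀ t ∈ sgn (T t.2)
      rw [show q₀ t = q₀ (t.1, t.2) from rfl, hq]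
      refine Finset.mem_image.2 ⟨p, hp𝓗, ?_⟩
      by_cases hpa : p ∈ T t.1
      · have hpb : p ∉ T t.2 := fun h => hpdiff ⟨fun _ => h, fun _ => hpa⟩
        simp [hpa, hpb]
      · have hpb : p ∈ T t.2 := by
          by_contra h; exact hpdiff ⟨fun h' => absurd h' hpa, fun h' => absurd h' h⟩
        simp [hpa, hpb]
    · -- full face
      have hplq : {x : E | ⟪(q₀ t).1, x⟫ = (q₀ t).2} = {x : E | ⟪p.1, x⟫ = p.2} := by
        rw [show q₀ t = q₀ (t.1, t.2) from rfl, hq]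
        by_cases hpa : p ∈ T t.1
        · simp only [hpa, if_true]
          ext x; simp only [mem_setOf_eq, inner_neg_left]; constructor <;> intro h <;> linarith
        · simp only [hpa, if_false]
      rw [hplq]
      apply Subset.antisymm
      · intro x hx
        refine ⟨hx.2, ?_⟩
        by_cases hpa : p ∈ T t.1
        · have hpb : p ∉ T t.2 := fun h => hpdiff ⟨fun _ => h, fun _ => hpa⟩
          exact closure_arrCell_inter_subset_plane 𝓗 (T t.1) (T t.2) hp𝓗 hpa hpb hx
        · have hpb : p ∈ T t.2 := by
            by_contra h; exact hpdiff ⟨fun h' => absurd h' hpa, fun h' => absurd h' h⟩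
          exact closure_arrCell_inter_subset_plane 𝓗 (T t.2) (T t.1) hp𝓗 hpb hpa ⟨hx.2, hx.1⟩
      · intro x hx
        exact ⟨closure_arrCell_inter_plane_subset_closure 𝓗 (T t.1) (T t.2) hpagree (hne t.1) hx, hx.1⟩
    · -- the normal
      obtain ⟨p', hp'𝓗, hp'sep, hν⟩ := hsepν t.1 t.2 hab
      have hp'diff : ¬ (p' ∈ T t.1 ↔ p' ∈ T t.2) := by
        rcases hp'sep with ⟨ha, hb'⟩ | ⟨hb', ha⟩
        · exact fun h => hb' (h.1 ha)
        · exact fun h => ha (h.2 hb')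
      have hpl : {x : E | ⟪p'.1, x⟫ = p'.2} = {x : E | ⟪p.1, x⟫ = p.2} := by
        rcases hpagree p' hp'𝓗 with h | h
        · exact absurd h hp'diff
        · exact h
      have hq1 : (q₀ t).1 = p.1 ∨ (q₀ t).1 = -p.1 := by
        rw [show q₀ t = q₀ (t.1, t.2) from rfl, hq]
        by_cases hpa : p ∈ T t.1
        · simp [hpa]
        · simp [hpa]
      rcases hplane_eq p hp𝓗 p' hp'𝓗 hpl with hpp | hpp
      · rw [hpp] at hν
        rcases hν with h | h <;> rcases hq1 with h' | h' <;> [left; right; right; left] <;>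
          simp [h, h']
      · rw [hpp] at hν
        simp only at hν
        rcases hν with h | h <;> rcases hq1 with h' | h' <;> [right; left; left; right] <;>
          simp [h, h']
  · -- P14: non-adjacent grain/exterior pairs meet inside two different planes
    intro f a ha b hb hab
    have hne' : a ≠ b := fun h => hb f (h ▸ ha)
    obtain ⟨p, hp𝓗, hpsep⟩ := exists_mem_not_mem_of_ne (hT𝓗 a) (hT𝓗 b) (hTinj a b hne')
    have hpdiff : ¬ (p ∈ T a ↔ p ∈ T b) := by
      rcases hpsep with ⟨h1', h2'⟩ | ⟨h2', h1'⟩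
      · exact fun h => h2' (h.1 h1')
      · exact fun h => h1' (h.2 h2')
    -- some differing constraint is off the plane of `p`
    have hex : ∃ p' ∈ 𝓗, ¬ (p' ∈ T a ↔ p' ∈ T b) ∧
        {x : E | ⟪p'.1, x⟫ = p'.2} ≠ {x : E | ⟪p.1, x⟫ = p.2} := by
      by_contra hall
      push Not at hall
      apply hab
      refine (hAdjmem (a, b)).2 ⟨⟨f, ha⟩, hb, p, hp𝓗, hpdiff, fun p' hp' => ?_⟩
      by_cases h : (p' ∈ T a ↔ p' ∈ T b)
      · exact Or.inl h
      · exact Or.inr (hall p' hp' (by tauto))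
    obtain ⟨p', hp'𝓗, hp'diff, hp'pl⟩ := hex
    refine ⟨p, hp𝓗, p', hp'𝓗, Ne.symm hp'pl, fun x hx => ⟨?_, ?_⟩⟩
    · by_cases hpa : p ∈ T a
      · have hpb : p ∉ T b := fun h => hpdiff ⟨fun _ => h, fun _ => hpa⟩
        exact closure_arrCell_inter_subset_plane 𝓗 (T a) (T b) hp𝓗 hpa hpb hx
      · have hpb : p ∈ T b := by
          by_contra h; exact hpdiff ⟨fun h' => absurd h' hpa, fun h' => absurd h' h⟩
        exact closure_arrCell_inter_subset_plane 𝓗 (T b) (T a) hp𝓗 hpb hpa ⟨hx.2, hx.1⟩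
    · by_cases hpa : p' ∈ T a
      · have hpb : p' ∉ T b := fun h => hp'diff ⟨fun _ => h, fun _ => hpa⟩
        exact closure_arrCell_inter_subset_plane 𝓗 (T a) (T b) hp'𝓗 hpa hpb hx
      · have hpb : p' ∈ T b := by
          by_contra h; exact hp'diff ⟨fun h' => absurd h' hpa, fun h' => absurd h' h⟩
        exact closure_arrCell_inter_subset_plane 𝓗 (T b) (T a) hp'𝓗 hpb hpa ⟨hx.2, hx.1⟩
  · -- P15: the covering property
    intro K R r hr hKR f a ha q hq w hw hxG hxE hoff
    have hqs := (mem_arrCell_iff 𝓗 (T a) q).1 hq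
    have hxN : q + r • w ∉ ⋃ p ∈ 𝓗, {y : E | ⟪p.1, y⟫ = p.2} := by
      intro h; obtain ⟨p, hp, hpx⟩ := mem_iUnion₂.1 h; exact hoff p hp hpx
    have hxcell := mem_arrCell_filter 𝓗 hxN
    -- the cell of `x = q + r w` is an enumerated (good, nonempty) cell
    obtain ⟨G, hG, hxG'⟩ := mem_iUnion₂.1 hxG
    have hGT : G ⊆ 𝓗.filter (fun p => ⟪p.1, q + r • w⟫ < p.2) := by
      intro p hp
      exact Finset.mem_filter.2 ⟨h𝒢 G hG hp, (mem_iInter₂.1 hxG') p hp⟩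
    obtain ⟨b, hb⟩ := hcompl _ (Finset.filter_subset _ _) ⟨G, hG, hGT⟩ ⟨q + r • w, hxcell⟩
    have hxb : q + r • w ∈ cell b := by
      show q + r • w ∈ ⋂ q' ∈ sgn (T b), {x : E | ⟪q'.1, x⟫ < q'.2}
      simp only [hsgn, hb]; exact hxcell
    have hbext : ∀ g, b ∉ S g := by
      intro g hbg
      exact hxE (mem_iUnion.2 ⟨g, mem_iUnion₂.2 ⟨b, hbg, hxb⟩⟩)
    rcases chimera_point_trichotomy_planes 𝓗 (T a) h1 (hT𝓗 a) hqs (hKR f) hw hr rfl hoff with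
      heq | ⟨p, hp𝓗, hpdiff, hpagree, hslab⟩ | ⟨p, hp𝓗, p', hp'𝓗, hpl, h1', h2'⟩
    · -- `x` in the cell of `a`: contradiction
      exfalso
      apply hxE
      refine mem_iUnion.2 ⟨f, mem_iUnion₂.2 ⟨a, ha, ?_⟩⟩
      show q + r • w ∈ ⋂ q' ∈ sgn (T a), {x : E | ⟪q'.1, x⟫ < q'.2}
      simp only [hsgn, ← heq]; exact hxcell
    · -- adjacent
      left
      have hpdiff' : ¬ (p ∈ T a ↔ p ∈ T b) := by rw [hb]; exact hpdiff
      have hpagree' : ∀ p' ∈ 𝓗, (p' ∈ T a ↔ p' ∈ T b) ∨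
          {x : E | ⟪p'.1, x⟫ = p'.2} = {x : E | ⟪p.1, x⟫ = p.2} := by
        intro p' hp'; rw [hb]; exact hpagree p' hp'
      have hadjab : adjP a b p := ⟨hp𝓗, hpdiff', hpagree'⟩
      have hmem : (a, b) ∈ Adj := (hAdjmem (a, b)).2 ⟨⟨f, ha⟩, hbext, p, hadjab⟩
      refine ⟨(a, b), hmem, hgrS f a ha, hxb, ?_⟩
      have hq := hq₀_of_adj a b p hadjab
      rw [hq]
      rcases hslab with ⟨hpa, hlo, hhi⟩ | ⟨hpa, hlo, hhi⟩
      · simp only [hpa, if_true, neg_neg, inner_neg_left]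
        linarith
      · simp only [hpa, if_false]
        rw [inner_neg_left] at hhi
        linarith
    · -- two different planes
      right
      exact ⟨p, hp𝓗, p', hp'𝓗, hpl, h1', h2'⟩

end Summit.Ventures.Crystal3D.Theorems

end
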